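import Literature.Analysis.FluidPDE.MildSolutions
import HarnessLib

/-!
# Kato solutions on `[0, T)` and the maximal time `T_max(u₀)` (Kato 1984; Rusin–Šverák 2011, §3)

Analysis/FluidPDE definition file. The tree phrases Kato's `L³` theory (Kato, Math. Z. 187 (1984),
Thm. 1 and Thm. 4; named facts `kato_local`, `kato_unique`, `kato_global_small`,
`HasGlobalKatoSolution` of `MildSolutions.lean`) through the four-clause class
"`u` is a mild solution of the unforced equations on `[0, T)` in duality form
(`IsMildNSSolutionOn (Ico 0 T) ν 0 u₀ u`), `u ∈ C([0,T); L³)` (`ContinuousInLpOn (Ico 0 T) 3 u`),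
`u 0 = u₀`, and `u` is measurable on `(0, T) × ℝ³`", written out in full at every use
(`kato_local`, `rusin_sverak_singular_point_of_blowup`, `rusin_sverak_weak_limit_of_singular_points`,
`kato_local_normalise`, …). This file names that class and the maximal time of existence built
from it:

* `IsKatoSolutionOn T ν u₀ u` — the four clauses, definitionally the conjunction used by
  `kato_local` (so `kato_local` reads `∃ T > 0, ∃ u, IsKatoSolutionOn T ν u₀ u`);
* `katoMaximalTime ν u₀ : ℝ≥0∞` — Rusin–Šverák's `T_max(u₀)` (arXiv:0911.0500, §1 p. 3: "we
  denote by `T_max(u₀)` the maximal time of existence of the mild solution starting at `u₀`";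
  §3 p. 5: "one always has local-in-time existence of the solution `u`, and one can define the
  maximal time of existence `T_max(u₀)` on which the solution of (3.13) exists"), rendered as the
  supremum in `[0, ∞]` of the lifespans `T` of Kato solutions with datum `u₀` (`0` if there is
  none, `∞` if they are arbitrarily long);

and **proves** the bookkeeping that makes `T_max` usable:

* `IsKatoSolutionOn.ae_eq` — two Kato solutions with the same datum agree a.e. at every common
  time (the named fact `kato_unique`, Kato 1984 Thm. 1 / Furioli–Lemarié-Rieusset–Terraneo 2000);
* `exists_isKatoSolutionOn_forall` — **gluing**: from Kato solutions `u n` on `[0, T n)` one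
  obtains a single field which is a Kato solution on every `[0, T n)` (select, at time `t`, the
  solution of least index alive at `t`; the duality identity, the `L³`-continuity and the
  measurability transfer because all candidates agree a.e. slice by slice);
* `katoMaximalTime_eq_top_iff` — `T_max(u₀) = ∞ ↔ HasGlobalKatoSolution ν u₀`, i.e. the
  identification "`T_max = ∞`" = "global Kato solution" asserted in the docstrings of
  `HasGlobalKatoSolution` and `rusin_sverak_minimal_blowup` (Rusin–Šverák §1), given `kato_unique`;
* `exists_isKatoSolutionOn_katoMaximalTime` — if `0 < T_max(u₀) < ∞` the maximal Kato solution
  on `[0, T_max)` exists (gluing along `T_n ↑ T_max`), and no Kato solution lives on a longer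
  interval (`not_isKatoSolutionOn_of_katoMaximalTime_lt`);
* `katoMaximalTime_pos` — `T_max(u₀) > 0` for weakly divergence-free `u₀ ∈ L³` (the named fact
  `kato_local`).

Physical space is `ℝ³` throughout (uniqueness in `C([0,T); L³)` is the three-dimensional
statement `kato_unique`). Nothing here is specific to Rusin–Šverák beyond the name `T_max`; the
file serves the refinement of `rusin_sverak_singular_point_of_blowup` (`RusinSverakWeakStability.lean`)
into the printed "`T_max(u₀) < ∞` forces a singularity at time `T_max`" (§4 p. 6).

## Mathlib / tree search

Tree: no maximal-time notion for mild `L³` solutions (`lean search 'maximalTime|Tmax|IsKatoSolution'`: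
none); the analogous *structural* notions `IsMaximalSmoothSolution` (`ClassicalSolution.lean`) and
`IsMaximalBesovMildSolution` (`CriticalRegularity.lean`) are "no extension past `T`" predicates on
a given solution, whereas Rusin–Šverák's `T_max(u₀)` is a function of the datum, which is what
Cor. 4.2 / Cor. 4.3 compare (`T_max(u₀) ≤ T`, `T_max(u₀) < ∞`). Mathlib: `iSup`, `Nat.find`,
`aestronglyMeasurable_iUnion_iff`, `nhdsWithin_inter_of_mem'`.

## References

* T. Kato, *Strong `L^p`-solutions of the Navier–Stokes equation in `ℝ^m`, with applications to
  weak solutions*, Math. Z. 187 (1984) 471–480, Thm. 1, Thm. 4.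
* W. Rusin, V. Šverák, *Minimal initial data for potential Navier–Stokes singularities*,
  J. Funct. Anal. 260 (2011) 879–891 = arXiv:0911.0500, §1 p. 3 and §3 p. 5 (`T_max(u₀)`).
* G. Furioli, P. G. Lemarié-Rieusset, E. Terraneo, Rev. Mat. Iberoam. 16 (2000), Thm. 1
  (uniqueness in `C([0,T); L³)`).
-/

noncomputable section

open MeasureTheory TopologicalSpace Set Function Filter Topology
open scoped ENNReal NNReal RealInnerProductSpace

namespace Literature.Analysis.FluidPDE

local notation "ℝ³" => EuclideanSpace ℝ (Fin 3)

/-! ## Kato solutions on `[0, T)` -/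

/-- **Kato solution on `[0, T)`** (Kato, Math. Z. 187 (1984), Thm. 1 (local class) and Thm. 4;
the class of the named facts `kato_local` / `kato_unique`): `u` is a mild solution of the
unforced Navier–Stokes equations with viscosity `ν` on `[0, T)` with datum `u₀` in duality form
(`IsMildNSSolutionOn (Ico 0 T) ν 0 u₀ u`, which includes weak divergence-freeness of every
slice), `u ∈ C([0,T); L³(ℝ³))`, `u 0 = u₀`, and `u` is (a.e.-strongly) measurable on the strip
`(0, T) × ℝ³`. Definitionally the conjunction appearing in `kato_local`. For `T ≤ 0` only the
clause `u 0 = u₀` has content. [cite: Kato1984, Thm. 1 and Thm. 4] -/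
def IsKatoSolutionOn (T ν : ℝ) (u₀ : ℝ³ → ℝ³) (u : ℝ → ℝ³ → ℝ³) : Prop :=
  IsMildNSSolutionOn (Ico 0 T) ν 0 u₀ u ∧ ContinuousInLpOn (Ico 0 T) 3 u ∧ u 0 = u₀ ∧
    AEStronglyMeasurable (uncurry u) (volume.restrict (Ioo 0 T ×ˢ univ))

namespace IsKatoSolutionOn

variable {T T' ν : ℝ} {u₀ : ℝ³ → ℝ³} {u v : ℝ → ℝ³ → ℝ³}

/-- A Kato solution is a mild solution on `[0, T)` (first clause). [cite: Kato1984, Thm. 1] -/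
theorem mild (h : IsKatoSolutionOn T ν u₀ u) : IsMildNSSolutionOn (Ico 0 T) ν 0 u₀ u := h.1

/-- A Kato solution lies in `C([0,T); L³)` (second clause). [cite: Kato1984, Thm. 1] -/
theorem continuousInLpOn (h : IsKatoSolutionOn T ν u₀ u) : ContinuousInLpOn (Ico 0 T) 3 u := h.2.1

/-- A Kato solution attains its datum, `u 0 = u₀` (third clause). [cite: Kato1984, Thm. 1] -/
theorem initial (h : IsKatoSolutionOn T ν u₀ u) : u 0 = u₀ := h.2.2.1

/-- A Kato solution is measurable on `(0, T) × ℝ³` (fourth clause). [folklore] -/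
theorem aestronglyMeasurable (h : IsKatoSolutionOn T ν u₀ u) :
    AEStronglyMeasurable (uncurry u) (volume.restrict (Ioo 0 T ×ˢ univ)) := h.2.2.2

/-- Every slice `u t`, `0 ≤ t < T`, of a Kato solution is an `L³` field. [cite: Kato1984, Thm. 1] -/
theorem memLp (h : IsKatoSolutionOn T ν u₀ u) {t : ℝ} (ht : t ∈ Ico 0 T) : MemLp (u t) 3 volume :=
  h.continuousInLpOn.1 t ht

/-- The datum of a Kato solution with positive lifespan is an `L³` field. [cite: Kato1984, Thm. 1] -/
theorem memLp_initial (h : IsKatoSolutionOn T ν u₀ u) (hT : 0 < T) : MemLp u₀ 3 volume :=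
  h.initial ▸ h.memLp ⟨le_rfl, hT⟩

/-- The datum of a Kato solution with positive lifespan is weakly divergence free (the slice at
`t = 0` is). [cite: Kato1984, Thm. 1] -/
theorem isWeaklyDivFree_initial (h : IsKatoSolutionOn T ν u₀ u) (hT : 0 < T) : IsWeaklyDivFree u₀ :=
  h.initial ▸ h.mild.1 0 ⟨le_rfl, hT⟩

/-- Restriction of a Kato solution to a shorter interval `[0, T')`, `T' ≤ T`. [folklore] -/
theorem mono (h : IsKatoSolutionOn T ν u₀ u) (hT : T' ≤ T) : IsKatoSolutionOn T' ν u₀ u :=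
  ⟨h.mild.mono (Ico_subset_Ico_right hT), h.continuousInLpOn.mono (Ico_subset_Ico_right hT),
    h.initial, h.aestronglyMeasurable.mono_measure
      (Measure.restrict_mono (prod_mono (Ioo_subset_Ioo_right hT) subset_rfl) le_rfl)⟩

/-- **Uniqueness** (the named fact `kato_unique`: Kato 1984, Thm. 1 within his class;
Furioli–Lemarié-Rieusset–Terraneo 2000, Thm. 1): two Kato solutions with the same datum and
viscosity `ν > 0` agree a.e. at every time of their common interval of existence.
[cite: Kato1984, Thm. 1] -/
theorem ae_eq (hU : kato_unique) (hν : 0 < ν) (hu : IsKatoSolutionOn T ν u₀ u)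
    (hv : IsKatoSolutionOn T' ν u₀ v) {t : ℝ} (ht : 0 ≤ t) (htT : t < T) (htT' : t < T') :
    u t =ᵐ[volume] v t := by
  have hu' := hu.mono (min_le_left T T')
  have hv' := hv.mono (min_le_right T T')
  have hpos : 0 < min T T' := lt_min (ht.trans_lt htT) (ht.trans_lt htT')
  exact hU hν (hu'.memLp_initial hpos) hu'.mild hv'.mild hu'.continuousInLpOn hv'.continuousInLpOn
    hu'.aestronglyMeasurable hv'.aestronglyMeasurable t ⟨ht, lt_min htT htT'⟩

end IsKatoSolutionOn

variable {T ν : ℝ} {u₀ : ℝ³ → ℝ³} {u : ℝ → ℝ³ → ℝ³}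

/-- A global Kato solution (`HasGlobalKatoSolution`, Kato 1984, Thm. 4) restricts to a Kato
solution on every `[0, T)`. [cite: Kato1984, Thm. 4] -/
theorem HasGlobalKatoSolution.exists_isKatoSolutionOn (h : HasGlobalKatoSolution ν u₀) (T : ℝ) :
    ∃ u, IsKatoSolutionOn T ν u₀ u := by
  obtain ⟨u, hmild, hcont, h0, hmeas⟩ := h
  exact ⟨u, hmild.mono Ico_subset_Ici_self, hcont.mono Ico_subset_Ici_self, h0,
    hmeas.mono_measure (Measure.restrict_mono (prod_mono Ioo_subset_Ioi_self subset_rfl) le_rfl)⟩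

/-! ## Gluing Kato solutions -/

/-- **Gluing of Kato solutions.** Let `u n` be Kato solutions on `[0, T n)` with a common datum
`u₀` and viscosity `ν > 0`. Then a single field `v` is a Kato solution on every `[0, T n)`:
`v t := u m t` for the least `m` with `t < T m` (and `u 0 t` if there is none). Indeed any two
candidates agree a.e. at `t` (`IsKatoSolutionOn.ae_eq`, i.e. `kato_unique`), and the four clauses
only see slices up to null sets: the duality identity through `∫ ⟪v τ, (v τ · ∇) ψ⟫`, the class
`C([0,T); L³)` through `‖v t - v t₀‖_{L³}`, and measurability on `(0, T n) × ℝ³` because `v`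
coincides with `u m` on the measurable slab where `m` is the selected index. [folklore] -/
theorem exists_isKatoSolutionOn_forall (hU : kato_unique) (hν : 0 < ν) {T : ℕ → ℝ}
    {u : ℕ → ℝ → ℝ³ → ℝ³} (h : ∀ n, IsKatoSolutionOn (T n) ν u₀ (u n)) :
    ∃ v : ℝ → ℝ³ → ℝ³, ∀ n, IsKatoSolutionOn (T n) ν u₀ v := by
  classical
  let v : ℝ → ℝ³ → ℝ³ := fun t => if ht : ∃ m, t < T m then u (Nat.find ht) t else u 0 t
  -- the selected index is alive at `t`
  have hsel : ∀ t m, t < T m → ∃ M, t < T M ∧ v t = u M t := fun t m htm => by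
    have hex : ∃ m, t < T m := ⟨m, htm⟩
    exact ⟨Nat.find hex, Nat.find_spec hex, by simp only [v, dif_pos hex]⟩
  -- hence `v` agrees a.e. with every solution alive at `t`
  have key : ∀ n t, 0 ≤ t → t < T n → v t =ᵐ[volume] u n t := fun n t ht0 htn => by
    obtain ⟨M, hM, hvt⟩ := hsel t n htn
    rw [hvt]
    exact (h M).ae_eq hU hν (h n) ht0 hM htn
  -- on the slab `S m` the selected index is `m`
  let S : ℕ → Set ℝ := fun m => Ioo 0 (T m) ∩ ⋂ j ∈ Finset.range m, Ici (T j)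
  have hS_meas : ∀ m, MeasurableSet (S m) := fun m =>
    measurableSet_Ioo.inter (Finset.measurableSet_biInter _ fun j _ => measurableSet_Ici)
  have hvS : ∀ m t, t ∈ S m → v t = u m t := fun m t ht => by
    have hex : ∃ k, t < T k := ⟨m, ht.1.2⟩
    have hfind : Nat.find hex = m := by
      rw [Nat.find_eq_iff]
      refine ⟨ht.1.2, fun j hj => not_lt.2 ?_⟩
      have := ht.2
      simp only [Finset.mem_range, mem_iInter] at this
      exact this j hj
    simp only [v, dif_pos hex, hfind]
  have hcover : ∀ n, Ioo 0 (T n) ×ˢ (univ : Set ℝ³) ⊆ ⋃ m, S m ×ˢ (univ : Set ℝ³) := fun n => by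
    rintro ⟨t, x⟩ ⟨⟨ht0, htn⟩, -⟩
    have hex : ∃ k, t < T k := ⟨n, htn⟩
    refine mem_iUnion.2 ⟨Nat.find hex, ⟨⟨ht0, Nat.find_spec hex⟩, ?_⟩, mem_univ _⟩
    simp only [Finset.mem_range, mem_iInter]
    exact fun j hj => not_lt.1 (Nat.find_min hex hj)
  refine ⟨v, fun n => ⟨⟨fun t ht => ?_, fun t ht => ?_⟩, ⟨fun t ht => ?_, fun t₀ ht₀ => ?_⟩, ?_, ?_⟩⟩
  · -- weak divergence-freeness of the slices
    obtain ⟨M, hM, hvt⟩ := hsel t n ht.2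
    rw [hvt]
    exact (h M).mild.1 t ⟨ht.1, hM⟩
  · -- the duality identity from the datum
    obtain ⟨M, hM, hvt⟩ := hsel t n ht.2
    intro φ hφ hdφ
    have H := (h M).mild.2 t ⟨ht.1, hM⟩ φ hφ hdφ
    rw [hvt, H]
    congr 1
    congr 1
    refine intervalIntegral.integral_congr fun τ hτ => ?_
    rw [uIcc_of_le ht.1] at hτ
    have hae : u M τ =ᵐ[volume] v τ :=
      ((h M).ae_eq hU hν (h M) hτ.1 (hτ.2.trans_lt hM) (hτ.2.trans_lt hM)).trans
        (key M τ hτ.1 (hτ.2.trans_lt hM)).symm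
    exact integral_congr_ae (hae.mono fun x hx => by simp only [convect, hx])
  · -- slices in `L³`
    obtain ⟨M, hM, hvt⟩ := hsel t n ht.2
    rw [hvt]
    exact (h M).memLp ⟨ht.1, hM⟩
  · -- continuity in `L³` within `[0, T n)`
    have hc := (h n).continuousInLpOn.2 t₀ ht₀
    refine hc.congr' ?_
    filter_upwards [self_mem_nhdsWithin] with t ht
    exact (eLpNorm_congr_ae ((key n t ht.1 ht.2).sub (key n t₀ ht₀.1 ht₀.2))).symm
  · -- the datum
    show (if ht : ∃ m, (0 : ℝ) < T m then u (Nat.find ht) 0 else u 0 0) = u₀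
    split_ifs with h0
    exacts [(h _).initial, (h 0).initial]
  · -- measurability on `(0, T n) × ℝ³`
    refine AEStronglyMeasurable.mono_measure ?_ (Measure.restrict_mono (hcover n) le_rfl)
    refine aestronglyMeasurable_iUnion_iff.2 fun m => ?_
    have hm : AEStronglyMeasurable (uncurry (u m)) (volume.restrict (S m ×ˢ (univ : Set ℝ³))) :=
      (h m).aestronglyMeasurable.mono_measure
        (Measure.restrict_mono (prod_mono inter_subset_left subset_rfl) le_rfl)
    refine hm.congr ?_
    filter_upwards [ae_restrict_mem ((hS_meas m).prod MeasurableSet.univ)] with z hz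
    simp only [uncurry, hvS m z.1 hz.1]

/-! ## The maximal time `T_max(u₀)` -/

/-- **Rusin–Šverák's maximal time of existence `T_max(u₀)`** of the mild (Kato) solution with
datum `u₀` and viscosity `ν` (arXiv:0911.0500, §1 p. 3 and §3 p. 5: "one can define the maximal
time of existence `T_max(u₀)` on which the solution of (3.13) exists"): the supremum in `[0, ∞]`
of the lifespans `T` of Kato solutions on `[0, T)` with datum `u₀` (`IsKatoSolutionOn`). It is `0`
when no Kato solution exists (e.g. `u₀ ∉ L³`), positive for weakly divergence-free `u₀ ∈ L³`
(`katoMaximalTime_pos`, by `kato_local`), and `∞` exactly when `u₀` has a global Kato solution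
(`katoMaximalTime_eq_top_iff`, by `kato_unique`). Rusin–Šverák work with Fujita–Kato's `Ḣ^{1/2}`
mild solutions; for `Ḣ^{1/2} ⊂ L³` data these are the Kato solutions with the same maximal time
(see the docstring of `HasGlobalKatoSolution`).
[cite: RusinSverak2011, §3 p. 5 (definition of T_max), arXiv:0911.0500] -/
def katoMaximalTime (ν : ℝ) (u₀ : ℝ³ → ℝ³) : ℝ≥0∞ :=
  ⨆ (T : ℝ) (_ : ∃ u, IsKatoSolutionOn T ν u₀ u), ENNReal.ofReal T

/-- A Kato solution on `[0, T)` witnesses `T ≤ T_max(u₀)`. [cite: RusinSverak2011, §3 p. 5] -/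
theorem IsKatoSolutionOn.ofReal_le_katoMaximalTime (h : IsKatoSolutionOn T ν u₀ u) :
    ENNReal.ofReal T ≤ katoMaximalTime ν u₀ :=
  le_iSup₂ (f := fun (T : ℝ) (_ : ∃ u, IsKatoSolutionOn T ν u₀ u) => ENNReal.ofReal T) T ⟨u, h⟩

/-- Below `T_max(u₀)` there are Kato solutions: if `τ < T_max(u₀)` then some Kato solution lives on
an interval `[0, T)` with `τ < T` (unfolding of the supremum). [cite: RusinSverak2011, §3 p. 5] -/
theorem exists_isKatoSolutionOn_of_lt_katoMaximalTime {τ : ℝ≥0∞} (h : τ < katoMaximalTime ν u₀) :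
    ∃ T : ℝ, τ < ENNReal.ofReal T ∧ ∃ u, IsKatoSolutionOn T ν u₀ u := by
  simp only [katoMaximalTime, lt_iSup_iff] at h
  obtain ⟨T, ⟨u, hu⟩, hlt⟩ := h
  exact ⟨T, hlt, u, hu⟩

/-- If `T < T_max(u₀)` (as elements of `[0, ∞]`) then a Kato solution lives on `[0, T)`.
[cite: RusinSverak2011, §3 p. 5] -/
theorem exists_isKatoSolutionOn_of_ofReal_lt_katoMaximalTime
    (h : ENNReal.ofReal T < katoMaximalTime ν u₀) : ∃ u, IsKatoSolutionOn T ν u₀ u := by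
  obtain ⟨T', hlt, u, hu⟩ := exists_isKatoSolutionOn_of_lt_katoMaximalTime h
  exact ⟨u, hu.mono (ENNReal.ofReal_lt_ofReal_iff'.1 hlt).1.le⟩

/-- **Maximality**: no Kato solution lives on `[0, T)` with `T_max(u₀) < T`.
[cite: RusinSverak2011, §3 p. 5] -/
theorem not_isKatoSolutionOn_of_katoMaximalTime_lt (h : katoMaximalTime ν u₀ < ENNReal.ofReal T) :
    ¬ IsKatoSolutionOn T ν u₀ u := fun hu =>
  absurd hu.ofReal_le_katoMaximalTime (not_le.2 h)

/-- `T_max(u₀) > 0` for weakly divergence-free `u₀ ∈ L³(ℝ³)` and `ν > 0`: local existence, the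
named fact `kato_local` (Kato 1984, Thm. 1; Rusin–Šverák §3 p. 5: "one always has local-in-time
existence"). [cite: Kato1984, Thm. 1] -/
theorem katoMaximalTime_pos (hL : kato_local) (hν : 0 < ν) (hu₀ : MemLp u₀ 3 volume)
    (hdiv : IsWeaklyDivFree u₀) : 0 < katoMaximalTime ν u₀ := by
  obtain ⟨T, hT, u, hu⟩ := hL ν hν u₀ hu₀ hdiv
  exact (ENNReal.ofReal_pos.2 hT).trans_le (IsKatoSolutionOn.ofReal_le_katoMaximalTime hu)

/-- A global Kato solution forces `T_max(u₀) = ∞`. [cite: RusinSverak2011, §1 p. 3] -/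
theorem HasGlobalKatoSolution.katoMaximalTime_eq_top (h : HasGlobalKatoSolution ν u₀) :
    katoMaximalTime ν u₀ = ⊤ := by
  refine ENNReal.eq_top_of_forall_nnreal_le fun r => ?_
  obtain ⟨u, hu⟩ := h.exists_isKatoSolutionOn r
  simpa only [ENNReal.ofReal_coe_nnreal] using hu.ofReal_le_katoMaximalTime

/-- **Assembly on an exhausted interval.** If `v` is a Kato solution on `[0, T n)` for every `n`,
`T n ≤ T'`, and every `t < T'` lies below some `T n`, then `v` is a Kato solution on `[0, T')`
(all four clauses are local in time; continuity at `t₀ < T n` within `[0, T')` is continuity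
within `[0, T n)`, a relative neighbourhood). [folklore] -/
theorem isKatoSolutionOn_of_forall {T : ℕ → ℝ} {T' : ℝ} {v : ℝ → ℝ³ → ℝ³}
    (hv : ∀ n, IsKatoSolutionOn (T n) ν u₀ v) (hle : ∀ n, T n ≤ T')
    (hcof : ∀ t < T', ∃ n, t < T n) : IsKatoSolutionOn T' ν u₀ v := by
  refine ⟨⟨fun t ht => ?_, fun t ht => ?_⟩, ⟨fun t ht => ?_, fun t₀ ht₀ => ?_⟩, (hv 0).initial, ?_⟩
  · obtain ⟨n, hn⟩ := hcof t ht.2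
    exact (hv n).mild.1 t ⟨ht.1, hn⟩
  · obtain ⟨n, hn⟩ := hcof t ht.2
    exact (hv n).mild.2 t ⟨ht.1, hn⟩
  · obtain ⟨n, hn⟩ := hcof t ht.2
    exact (hv n).memLp ⟨ht.1, hn⟩
  · obtain ⟨n, hn⟩ := hcof t₀ ht₀.2
    have hc := (hv n).continuousInLpOn.2 t₀ ⟨ht₀.1, hn⟩
    have hfilter : 𝓝[Ico 0 (T n)] t₀ = 𝓝[Ico 0 T'] t₀ := by
      have hIco : Ico 0 (T n) = Ico 0 T' ∩ Iio (T n) := by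
        rw [Ico_inter_Iio, min_eq_right (hle n)]
      rw [hIco]
      exact nhdsWithin_inter_of_mem' (mem_nhdsWithin_of_mem_nhds (Iio_mem_nhds hn))
    rwa [hfilter] at hc
  · have hset : Ioo 0 T' ×ˢ (univ : Set ℝ³) = ⋃ n, Ioo 0 (T n) ×ˢ (univ : Set ℝ³) := by
      rw [← iUnion_prod_const]
      congr 1
      refine Subset.antisymm (fun t ht => ?_) (iUnion_subset fun n => Ioo_subset_Ioo_right (hle n))
      obtain ⟨n, hn⟩ := hcof t ht.2
      exact mem_iUnion.2 ⟨n, ht.1, hn⟩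
    rw [hset]
    exact aestronglyMeasurable_iUnion_iff.2 fun n => (hv n).aestronglyMeasurable

/-- **`T_max(u₀) = ∞` gives a global Kato solution** (given uniqueness `kato_unique`): Kato
solutions on `[0, n)`, `n ∈ ℕ`, exist below `T_max = ∞` and glue (`exists_isKatoSolutionOn_forall`)
to a mild solution in `C([0,∞); L³)`. This is the direction "`T_max = ∞` ⟹ globally
well-posed" of Rusin–Šverák's identification (§1 p. 3). [cite: RusinSverak2011, §1 p. 3] -/
theorem hasGlobalKatoSolution_of_katoMaximalTime_eq_top (hU : kato_unique) (hν : 0 < ν)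
    (h : katoMaximalTime ν u₀ = ⊤) : HasGlobalKatoSolution ν u₀ := by
  have hn : ∀ n : ℕ, ∃ u, IsKatoSolutionOn (n : ℝ) ν u₀ u := fun n =>
    exists_isKatoSolutionOn_of_ofReal_lt_katoMaximalTime (by rw [h]; exact ENNReal.ofReal_lt_top)
  choose u hu using hn
  obtain ⟨v, hv⟩ := exists_isKatoSolutionOn_forall hU hν hu
  have hcof : ∀ t : ℝ, ∃ n : ℕ, t < n := fun t => exists_nat_gt t
  refine ⟨v, ⟨fun t ht => ?_, fun t ht => ?_⟩, ⟨fun t ht => ?_, fun t₀ ht₀ => ?_⟩, (hv 0).initial, ?_⟩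
  · obtain ⟨n, hn⟩ := hcof t
    exact (hv n).mild.1 t ⟨ht, hn⟩
  · obtain ⟨n, hn⟩ := hcof t
    exact (hv n).mild.2 t ⟨ht, hn⟩
  · obtain ⟨n, hn⟩ := hcof t
    exact (hv n).memLp ⟨ht, hn⟩
  · obtain ⟨n, hn⟩ := hcof t₀
    have hc := (hv n).continuousInLpOn.2 t₀ ⟨ht₀, hn⟩
    have hfilter : 𝓝[Ico 0 (n : ℝ)] t₀ = 𝓝[Ici 0] t₀ := by
      rw [← Ici_inter_Iio]
      exact nhdsWithin_inter_of_mem' (mem_nhdsWithin_of_mem_nhds (Iio_mem_nhds hn))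
    rwa [hfilter] at hc
  · have hset : Ioi (0 : ℝ) ×ˢ (univ : Set ℝ³) = ⋃ n : ℕ, Ioo 0 (n : ℝ) ×ˢ (univ : Set ℝ³) := by
      rw [← iUnion_prod_const]
      congr 1
      refine Subset.antisymm (fun t ht => ?_) (iUnion_subset fun n => Ioo_subset_Ioi_self)
      obtain ⟨n, hn⟩ := hcof t
      exact mem_iUnion.2 ⟨n, ht, hn⟩
    rw [hset]
    exact aestronglyMeasurable_iUnion_iff.2 fun n => (hv n).aestronglyMeasurable

/-- **`T_max(u₀) = ∞` iff `u₀` has a global Kato solution** (given `kato_unique`): the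
identification of Rusin–Šverák's "`T_max(u₀) = +∞`" (§1 p. 3, definition of `ρ_max`) with the
tree's `HasGlobalKatoSolution`, as used in `rusinSverakRhoMaxPure` and
`rusin_sverak_minimal_blowup`. [cite: RusinSverak2011, §1 p. 3] -/
theorem katoMaximalTime_eq_top_iff (hU : kato_unique) (hν : 0 < ν) :
    katoMaximalTime ν u₀ = ⊤ ↔ HasGlobalKatoSolution ν u₀ :=
  ⟨hasGlobalKatoSolution_of_katoMaximalTime_eq_top hU hν, HasGlobalKatoSolution.katoMaximalTime_eq_top⟩

/-- **The maximal Kato solution exists**: if `0 < T_max(u₀) < ∞` then (given `kato_unique`) there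
is a Kato solution on the whole of `[0, T_max(u₀))` — glue solutions on `[0, T_max - T_max/(n+1))`.
This is "the mild solution starting at `u₀`" on its "maximal interval of existence
`(0, T_max(u₀))`" of Rusin–Šverák (§3 p. 5, Cor. 4.1). [cite: RusinSverak2011, §3 p. 5] -/
theorem exists_isKatoSolutionOn_katoMaximalTime (hU : kato_unique) (hν : 0 < ν)
    (h0 : 0 < katoMaximalTime ν u₀) (htop : katoMaximalTime ν u₀ < ⊤) :
    ∃ u, IsKatoSolutionOn (katoMaximalTime ν u₀).toReal ν u₀ u := by
  set Tm := (katoMaximalTime ν u₀).toReal with hTm_def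
  have hTm : ENNReal.ofReal Tm = katoMaximalTime ν u₀ := ENNReal.ofReal_toReal htop.ne
  have hTm_pos : 0 < Tm := ENNReal.toReal_pos h0.ne' htop.ne
  let T : ℕ → ℝ := fun n => Tm - Tm / (n + 1)
  have hTlt : ∀ n, T n < Tm := fun n => by
    have : 0 < Tm / (n + 1) := by positivity
    simp only [T]; linarith
  have hn : ∀ n : ℕ, ∃ u, IsKatoSolutionOn (T n) ν u₀ u := fun n =>
    exists_isKatoSolutionOn_of_ofReal_lt_katoMaximalTime
      (by rw [← hTm]; exact ENNReal.ofReal_lt_ofReal_iff'.2 ⟨hTlt n, hTm_pos⟩)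
  choose u hu using hn
  obtain ⟨v, hv⟩ := exists_isKatoSolutionOn_forall hU hν hu
  refine ⟨v, isKatoSolutionOn_of_forall hv (fun n => (hTlt n).le) fun t ht => ?_⟩
  -- `t < Tm - Tm/(n+1)` as soon as `Tm/(Tm - t) < n + 1`
  obtain ⟨n, hn⟩ := exists_nat_gt (Tm / (Tm - t))
  refine ⟨n, ?_⟩
  have hpos : 0 < Tm - t := sub_pos.2 ht
  have h1 : Tm < (n + 1) * (Tm - t) := by
    rw [div_lt_iff₀ hpos] at hn
    nlinarith
  have h2 : Tm / (n + 1) < Tm - t := by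
    rw [div_lt_iff₀ (by positivity)]
    linarith
  simp only [T]
  linarith

end Literature.Analysis.FluidPDE
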